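import Summits.Ventures.PercRepro.C041TriangleStar2Star2A
import Summits.Ventures.PercRepro.C041TriangleStar2Star2B
import Summits.Ventures.PercRepro.C041TriangleStar2Star2C
import Summits.Ventures.PercRepro.C041TriangleStar2Star2D
import Summits.Ventures.PercRepro.C041TriangleStar2Star2E
import Summits.Ventures.PercRepro.C041TriangleStar2Star2F
import Summits.Ventures.PercRepro.C041TriangleStar2Star2G
import Summits.Ventures.PercRepro.C041TriangleStar2Star2H
import Summits.Ventures.PercRepro.C041TriangleStar2Star2I
import Summits.Ventures.PercRepro.C041TriangleStar2Star2J
import Summits.Ventures.PercRepro.C041TriangleStar2Star2K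
import Summits.Ventures.PercRepro.C041TriangleStar2Star2L
import Summits.Ventures.PercRepro.C041TriangleStar2Star2M
import Summits.Ventures.PercRepro.C041TriangleStar2Star2N
import Summits.Ventures.PercRepro.C041TriangleStar2Star2O
import Summits.Ventures.PercRepro.C041TriangleStar2Star2P

/-!
# THEOREM (TWO-LEAF STAR × TWO-LEAF STAR) — coordinate 3 of the identity `θ_△(v a * v b, v c * v d) = star2Star2A a b c d + star2Star2B a b c d + star2Star2C a b c d + star2Star2D a b c d + star2Star2E a b c d + star2Star2F a b c d + star2Star2G a b c d + star2Star2H a b c d + star2Star2I a b c d + star2Star2J a b c d + star2Star2K a b c d + star2Star2L a b c d + star2Star2M a b c d + star2Star2N a b c d + star2Star2O a b c d + star2Star2P a b c d` (mine-3, gen 67; C-041.md §21 (bg)): the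
explicit certificate's coordinate 3 agrees with the triangle map's, by `ring` over the parts' definitions (one
coordinate per module: the six expansions of 1778 terms each exceed one farm node together).
-/

namespace PercRepro

namespace RelaxedTriangle

open TreeClosure

set_option maxHeartbeats 800000 in
/-- Coordinate 3 of the identity. -/
theorem thetaTri_star2Star2_coord3 (a b c d : ℝ) :
    thetaTri (v a * v b) (v c * v d) 3 = (star2Star2A a b c d + star2Star2B a b c d + star2Star2C a b c d + star2Star2D a b c d + star2Star2E a b c d + star2Star2F a b c d + star2Star2G a b c d + star2Star2H a b c d + star2Star2I a b c d + star2Star2J a b c d + star2Star2K a b c d + star2Star2L a b c d + star2Star2M a b c d + star2Star2N a b c d + star2Star2O a b c d + star2Star2P a b c d) 3 := by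
  simp only [star2Star2A, star2Star2B, star2Star2C, star2Star2D, star2Star2E, star2Star2F, star2Star2G, star2Star2H, star2Star2I, star2Star2J, star2Star2K, star2Star2L, star2Star2M, star2Star2N, star2Star2O, star2Star2P, star2Star2A1, star2Star2A2, star2Star2B1, star2Star2B2, star2Star2B3, star2Star2C1, star2Star2C2, star2Star2D1, star2Star2D2, star2Star2E1, star2Star2E2, star2Star2E3, star2Star2E4, star2Star2F1, star2Star2F2, star2Star2F3, star2Star2F4, star2Star2F5, star2Star2F6, star2Star2F7, star2Star2F8, star2Star2G1, star2Star2G2, star2Star2G3, star2Star2G4, star2Star2G5, star2Star2G6, star2Star2G7, star2Star2G8, star2Star2H1, star2Star2H2, star2Star2H3, star2Star2H4, star2Star2H5, star2Star2H6, star2Star2H7, star2Star2H8, star2Star2I1, star2Star2I2, star2Star2I3, star2Star2I4, star2Star2I5, star2Star2I6, star2Star2I7, star2Star2I8, star2Star2J1, star2Star2J2, star2Star2J3, star2Star2J4, star2Star2K1, star2Star2K2, star2Star2L1, star2Star2L2, star2Star2L3, star2Star2L4, star2Star2M1, star2Star2M2, star2Star2M3, star2Star2N1, star2Star2N2, star2Star2N3,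 star2Star2O1, star2Star2O2, star2Star2O3, star2Star2P1, star2Star2P2, thetaTri_eq_vec, Pi.add_apply, Pi.smul_apply, Pi.mul_apply, Pi.one_apply, smul_eq_mul, v]
  simp
  ring

end RelaxedTriangle

end PercRepro
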